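import Summits.QuantumFields.BalabanUV.Beta.EriceRemainderEnclosureHistoryRenewal
import Summits.QuantumFields.BalabanUV.Beta.EriceRemainderEnclosureHistoryRenewalExtremal

/-!
# EriceRemainderEnclosureHistoryRenewalExtremalRuns — (E34b) the ROW SYSTEM as ONE interface: what NE4-as-typed's row split hands the
# renewal of station (E33) about two infrared-pinned runs of (0.20) (by name), and the exponent-½ form of (E34a)'s envelope: no bound
# `C·exp(−A·j^p)` with `p > ½` follows from the row system

Cell `pub-balaban`, β-function sub-cell, BINDER row D4 «RemainderConst leaves for Bałaban's split» (`HOME/BINDER-OWNERS.md`; owner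
lineage `b2b-balaban-beta-an4`; this file by co-owner #2 lineage `b2b-balaban-beta-d4-p2`, generation 36), β-FLOW TEAM duty (1),
FREEZE (0) honoured (def-free; no new leaf, no new hypothesis shape).  Companion of (E34a) `EriceRemainderEnclosureHistoryRenewalExtremal`
(the extremal block solutions of the row system, ABSTRACT) over (E33a) `EriceRemainderEnclosureHistoryRenewal` (the row split from
`ScaleShiftRate` + rows, β-side) and node U2's `T4CouplingMatching` (`disc`, `disc_pin`, `disc_nonneg`).

HONEST FRAMING (page 1, verbatim and binding).  *"Discharging BetaPertH makes Bałaban's UV stability UNCONDITIONAL — a real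
constructive-QFT result; it is NOT the continuum limit and NOT the Clay problem."*  THIS FILE DISCHARGES NOTHING OF THE KIND.  §1 is a
by-name repackaging of (E33a) for an ABSTRACT family `β : FlowStep.HBeta` under NOT-IN-PRINT binders (`ScaleShiftRate c θ γ β`, GAPS
G-t4-U2-1; `HistLipschitz Λ γ β` with k-uniform rows, GAPS G-t4-U2-2); §2 is [folklore] real analysis on abstract sequences.  Nothing of
Bałaban's [I] (1.22) is quoted newly, typed or asserted (loci verbatim in the headers of `FlowStep` ∕ `T4CouplingMatching`).  Row D4 class
UNCHANGED (critical-path width 0; instance 0∕1; D4 DISCHARGE NO DATE); NOT B12 Thm 2, NOT BetaPertH, NOT continuum, NOT Clay.  HONEST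
DEPENDENCY: continuum YM on T⁴ ⇐ BetaPertH ∧ nine spine estimates (0/9 proved); BetaPertH ⇐ (D1) ∧ (D4) ∧ CAP+tail; G-an2-4 gates asym, D1
and NE2/3/4.

THE POINT (census sense (α), the history channel's RATE row after (E33)).  (E33c) `disc_le_stretched`, (E33f) `disc_le_log` and (E33g)
`disc_le_sqrt_uniform` see the two runs ONLY through the ROW SYSTEM of §1 `disc_rowSystem`: `δ = disc gA gB ≥ 0`, `δ_K = 0`, weights
`w_l = (g^A_l)²g^B_{l+1} ≥ 0` (whose sum node U2 bounds by `U = (k₀+1)γ³ + 2γ∕b` along asymptotically free runs), and for every row `l < K`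
the split `δ_l ≤ δ_{l+1} + cθ^l + 2(cθ^s∕(1−θ)) + A³M·w_l·B′` for EVERY window `s` and bound `B′` of `δ` on `[l−s, l]`, plus the full-window
row.  (E34a) shows that this system — with the same constants and with weights dominated by the asymptotic-freedom profile — has solutions
above `c·exp(−B·L·log L)` at `j = L²`; §2 `rowSystem_not_stretched_pow` draws the exponent form: for every `p > ½`, `A > 0`, `C > 0` some
solution has `δ_j > C·exp(−A·j^p)`.  So through the row system the two-run matching rate WITHOUT `FadingMemory` is stretched-exponential
with exponent EXACTLY `½` up to logarithms ((E33g) from above, (E34a)∕§2 from below); node U2's geometric `InjectedRate C 0 θ` needs the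
decay hypothesis or a β-level input beyond the row split.  SCOPE (binding): method-level; a β-level lower bound (an admissible history family
realizing the extremal solutions) stays OPEN.

WHAT IS PROVED (0 `def`, 0 sorry): §1 `disc_rowSystem` (by name: (E33a) `disc_row_split` ∕ `disc_row_full`, node U2's `disc_pin` ∕
`disc_nonneg`); §2 `rowSystem_not_stretched_pow` ([folklore]: (E34a) `rowSystem_instance` ∕ `rowSystem_envelope` + `log x = o(x^{2p−1})`).
-/

noncomputable section
open Finset Filter Topology Asymptotics

namespace Summit.QuantumFields.BalabanUV.Beta.EriceRemainderEnclosureHistoryRenewalExtremalRuns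

open Literature.MathematicalPhysics.QuantumFieldTheory.Balaban1983to89
open Literature.MathematicalPhysics.QuantumFieldTheory.Balaban1983to89.FlowStep
open Literature.MathematicalPhysics.QuantumFieldTheory.Balaban1983to89.T4CouplingMatching
open Summit.QuantumFields.BalabanUV.Beta.EriceRemainderEnclosureHistoryRenewal (disc_row_split disc_row_full)
open Summit.QuantumFields.BalabanUV.Beta.EriceRemainderEnclosureHistoryRenewalExtremal (rowSystem_instance rowSystem_envelope)

/-! ## §1 The row system of two infrared-pinned runs (by name) -/

/-- **THE ROW SYSTEM OF TWO PINNED RUNS (interface of (E33c)∕(E33f)∕(E33g), by name).**  Two runs of (0.20) with the SAME history family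
`β` — A: `K` steps, B: `K + 1` steps — all couplings in ]0,γ], pinned `g^A_K = g^B_{K+1}`; NE4 as `ScaleShiftRate c θ γ β` (`c ≥ 0`,
`0 ≤ θ < 1`); `HistLipschitz Λ γ β`, `Λ ≥ 0`, rows `Σ_{i≤k} Λ k i ≤ M`; near-monotone runs with constant `A ≥ 0`.  THEN, with
`δ := disc gA gB` and the AF weights `w_l := (g^A_l)²g^B_{l+1}`: `δ ≥ 0`; `δ_K = 0`; `w_l ≥ 0` (`l ≤ K`); every row `l < K` splits for EVERY
window `s` as `δ_l ≤ δ_{l+1} + cθ^l + 2(cθ^s∕(1−θ)) + A³M·w_l·B′` for every bound `B′` of `δ` on `[l−s, l]`, and satisfies the full-window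
row `δ_l ≤ δ_{l+1} + cθ^l + A³M·w_l·B′` for every bound `B′` of `δ` on `[0, l]` — exactly the hypothesis shapes of (E34a)
`rowSystem_not_geometric`'s instances (`m = A³M`).  Every hypothesis on `β` is an UNPRINTED input (GAPS G-t4-U2-1∕-2).
[cite: Balaban1987RG1, (0.20) p.256 and §5 p.298] -/
theorem disc_rowSystem {β : HBeta} {γ c θ M A : ℝ} {Λ : ℕ → ℕ → ℝ} {K : ℕ} {gA gB : ℕ → ℝ}
    (hc : 0 ≤ c) (hθ0 : 0 ≤ θ) (hθ1 : θ < 1)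
    (hA : RGEqH K β gA) (hB : RGEqH (K + 1) β gB)
    (hAbox : ∀ i, i ≤ K → 0 < gA i ∧ gA i ≤ γ) (hBbox : ∀ i, i ≤ K + 1 → 0 < gB i ∧ gB i ≤ γ)
    (hpin : gA K = gB (K + 1))
    (hS : ScaleShiftRate c θ γ β) (hL : HistLipschitz Λ γ β) (hΛ : ∀ k i, i ≤ k → 0 ≤ Λ k i)
    (hrow : ∀ k, ∑ i ∈ range (k + 1), Λ k i ≤ M) (hA0 : 0 ≤ A)
    (hmA : ∀ i j, i ≤ j → j ≤ K → gA i ≤ A * gA j) (hmB : ∀ i j, i ≤ j → j ≤ K + 1 → gB i ≤ A * gB j) :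
    (∀ j, 0 ≤ disc gA gB j) ∧ disc gA gB K = 0 ∧ (∀ j, j ≤ K → 0 ≤ (gA j) ^ 2 * gB (j + 1)) ∧
    (∀ j, j < K → ∀ s : ℕ, ∀ B' : ℝ, (∀ i, j - s ≤ i → i ≤ j → disc gA gB i ≤ B') →
      disc gA gB j ≤ disc gA gB (j + 1) + c * θ ^ j + 2 * (c * θ ^ s / (1 - θ))
        + A ^ 3 * M * ((gA j) ^ 2 * gB (j + 1)) * B') ∧
    (∀ j, j < K → ∀ B' : ℝ, (∀ i, i ≤ j → disc gA gB i ≤ B') →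
      disc gA gB j ≤ disc gA gB (j + 1) + c * θ ^ j + A ^ 3 * M * ((gA j) ^ 2 * gB (j + 1)) * B') :=
  ⟨disc_nonneg gA gB, disc_pin hpin,
    fun j hj => mul_nonneg (sq_nonneg _) (hBbox (j + 1) (by omega)).1.le,
    fun j hj s B' hB' => disc_row_split (s := s) hc hθ0 hθ1 hA hB hAbox hBbox hS hL hΛ hrow hA0 hmA hmB hj hB',
    fun j hj B' hB' => disc_row_full hA hB hAbox hBbox hS hL hΛ hrow hA0 hmA hmB hj hB'⟩

/-! ## §2 No `exp(−A·j^p)` bound with `p > ½` follows from the row system -/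

/-- **THE EXPONENT `½` CANNOT BE RAISED THROUGH THE ROW SYSTEM.**  For ALL constants `c > 0`, `0 < θ < 1`, `m > 0`, `U > 0` and every
`p > ½`, `A > 0`, `C > 0` there are `K`, weights `w` (`≥ 0`, `Σ_{l≤K} w_l ≤ U`, non-decreasing towards the pin, `≤ U∕(K−l+1)²`) and a
solution `δ` of the row system (`δ ≥ 0` non-increasing, `δ_K = 0`, every row split for every window with deletion term `2(cθ^s∕(1−θ))`, every
full-window row) with `δ_j > C·exp(−A·j^p)` at some `j ≤ K` — (E34a) `rowSystem_instance` at a size `L` with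
`B·L·log L + log(C∕c) < A·(L²)^p` (`log x = o(x^{2p−1})`), read through (E34a) `rowSystem_envelope`.  With (E33g) (`≤ L′·ρ^⌊√j⌋` for EVERY
solution) the row system's extremal rate is `exp(−Θ̃(√j))`: exponent exactly `½` up to logarithms. [folklore] -/
theorem rowSystem_not_stretched_pow {c θ m U C A p : ℝ} (hc : 0 < c) (hθ0 : 0 < θ) (hθ1 : θ < 1) (hm : 0 < m) (hU : 0 < U)
    (hC : 0 < C) (hA : 0 < A) (hp : 1 / 2 < p) :
    ∃ (K : ℕ) (w δ : ℕ → ℝ) (j : ℕ), (∀ l, 0 ≤ w l) ∧ (∑ l ∈ range (K + 1), w l ≤ U) ∧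
      (∀ i j, i ≤ j → j ≤ K → w i ≤ w j) ∧ (∀ l, w l ≤ U / (((K - l : ℕ) : ℝ) + 1) ^ 2) ∧
      (∀ l, 0 ≤ δ l) ∧ (∀ i j, i ≤ j → δ j ≤ δ i) ∧ δ K = 0 ∧
      (∀ l, l < K → ∀ s : ℕ, ∀ B' : ℝ, (∀ i, l - s ≤ i → i ≤ l → δ i ≤ B') →
        δ l ≤ δ (l + 1) + c * θ ^ l + 2 * (c * θ ^ s / (1 - θ)) + m * w l * B') ∧
      (∀ l, l < K → ∀ B' : ℝ, (∀ i, i ≤ l → δ i ≤ B') → δ l ≤ δ (l + 1) + c * θ ^ l + m * w l * B') ∧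
      j ≤ K ∧ C * Real.exp (-A * (j : ℝ) ^ p) < δ j := by
  have hmU : 0 < m * U := mul_pos hm hU
  set B : ℝ := 4 + (Real.log 4 + |Real.log (m * U)| + 2 * |Real.log θ|) / Real.log 2 with hBdef
  have hlog2 : 0 < Real.log 2 := Real.log_pos (by norm_num)
  have hB0 : 0 < B := by
    have : 0 ≤ Real.log 4 := Real.log_nonneg (by norm_num)
    positivity
  -- eventually (in ℝ): `B·x·log x + log(C∕c) < A·(x²)^p`, since `log x = o(x^{2p−1})`
  have hq : 0 < 2 * p - 1 := by linarith
  have hev : ∀ᶠ x : ℝ in atTop, B * x * Real.log x + Real.log (C / c) < A * (x ^ 2) ^ p := by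
    have h1 : ∀ᶠ x : ℝ in atTop, ‖Real.log x‖ ≤ A / (2 * B) * ‖x ^ (2 * p - 1)‖ :=
      (isLittleO_log_rpow_atTop hq).bound (by positivity)
    have h2 : Tendsto (fun x : ℝ => x ^ (2 * p)) atTop atTop := tendsto_rpow_atTop (by linarith)
    have h3 : ∀ᶠ x : ℝ in atTop, Real.log (C / c) * (2 / A) + 1 ≤ x ^ (2 * p) := h2.eventually_ge_atTop _
    filter_upwards [h1, h3, eventually_ge_atTop (1 : ℝ)] with x hx1 hx3 hx
    have hx0 : 0 < x := by linarith
    have hlog0 : 0 ≤ Real.log x := Real.log_nonneg hx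
    rw [Real.norm_eq_abs, Real.norm_eq_abs, abs_of_nonneg hlog0, abs_of_nonneg (Real.rpow_nonneg hx0.le _)] at hx1
    have e1 : (x ^ 2) ^ p = x ^ (2 * p) := by
      rw [← Real.rpow_two, ← Real.rpow_mul hx0.le]
    have e2 : x * x ^ (2 * p - 1) = x ^ (2 * p) := by
      rw [mul_comm, ← Real.rpow_add_one hx0.ne']; ring_nf
    have h4 : B * x * Real.log x ≤ A / 2 * x ^ (2 * p) := by
      have h5 := mul_le_mul_of_nonneg_left hx1 (by positivity : 0 ≤ B * x)
      calc B * x * Real.log x ≤ B * x * (A / (2 * B) * x ^ (2 * p - 1)) := h5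
        _ = A / 2 * (x * x ^ (2 * p - 1)) := by field_simp
        _ = A / 2 * x ^ (2 * p) := by rw [e2]
    have h6 : Real.log (C / c) < A / 2 * x ^ (2 * p) := by
      have hA2 : 0 < A / 2 := by positivity
      have e3 : Real.log (C / c) = A / 2 * (Real.log (C / c) * (2 / A)) := by field_simp
      rw [e3]
      exact mul_lt_mul_of_pos_left (by linarith) hA2
    rw [e1]
    linarith
  obtain ⟨L, hL2, hL⟩ : ∃ L : ℕ, 2 ≤ L ∧ B * L * Real.log L + Real.log (C / c) < A * ((L : ℝ) ^ 2) ^ p := by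
    have h := (tendsto_natCast_atTop_atTop (R := ℝ)).eventually hev
    exact ((eventually_ge_atTop 2).and h).exists
  -- the instance at size `L`
  set R : ℝ := max 1 (4 * (L : ℝ) ^ 4 / (m * U)) with hRdef
  have hR1 : 1 ≤ R := le_max_left _ _
  have hR : 4 * (L : ℝ) ^ 4 ≤ R * (m * U) := by
    have : 4 * (L : ℝ) ^ 4 / (m * U) ≤ R := le_max_right _ _
    rwa [div_le_iff₀ hmU] at this
  obtain ⟨K, w, δ, hK, hw0, hwsum, hwmono, hwdom, hδ0, hanti, hpin, hrows, hfull, hval⟩ :=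
    rowSystem_instance hc.le hθ0.le hθ1 hm.le hU.le hR1 hL2 hR
  have henv := rowSystem_envelope (L := L) hc hθ0 hθ1 hmU hL2
  rw [← hBdef, ← hRdef] at henv
  refine ⟨K, w, δ, L ^ 2, hw0, hwsum, hwmono, hwdom, hδ0, hanti, hpin, hrows, hfull, by rw [hK]; omega, ?_⟩
  rw [hval]
  refine lt_of_lt_of_le ?_ henv
  -- `C·exp(−A(L²)^p) < c·exp(−B·L·log L)` from `log(C∕c) < A(L²)^p − B·L·log L`
  push_cast
  have h6 : Real.log (C / c) < -B * L * Real.log L - -A * ((L : ℝ) ^ 2) ^ p := by linarith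
  have h7 : C / c < Real.exp (-B * L * Real.log L) / Real.exp (-A * ((L : ℝ) ^ 2) ^ p) := by
    rw [← Real.exp_sub]
    calc C / c = Real.exp (Real.log (C / c)) := (Real.exp_log (div_pos hC hc)).symm
      _ < _ := Real.exp_lt_exp.mpr h6
  have h8 := (div_lt_div_iff₀ hc (Real.exp_pos _)).mp h7
  linarith

end Summit.QuantumFields.BalabanUV.Beta.EriceRemainderEnclosureHistoryRenewalExtremalRuns

end
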